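import Literature.NumberTheory.EllipticCurves.JetchevSkinnerWan2017.AnticyclotomicControl
import Summits.BirchSwinnertonDyer.Rank1Residual.Partition.MainConjecturesControlPublishedClass
import HarnessLib

/-!
# (CTL)ᵍ FED BY Jetchev–Skinner–Wan 2017 Thm. 3.3.1 at EVERY good prime `p ≥ 3` — anomalous and
# supersingular included — and the irreducible rank-one rows with the control link PUBLISHED at every
# pair (cell `b2b-bsdres`, GLUE seat gen 6; companion of `AnticyclotomicControlPublished{,Places}.lean`
# (lit-cgls) and `MainConjecturesControlPublishedClass.lean` (gen 5))

HONEST FRAMING (cell `b2b-bsdres`, run/shared/lean/b2b/bsd-rank1-residual/, verbatim in every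
file): the goal of the cell is to DELETE the COMBINATION-SHAPED residual classes of the
Birch–Swinnerton-Dyer formula for ALL analytic-rank `≤ 1` elliptic curves over `ℚ` — "full BSD
formula for every rank `≤ 1` curve in class `C`" assembled STRICTLY from published theorems — so
that the rank-`≤ 1` remainder becomes exactly the CONSTRUCTION-SHAPED classes, which are TYPED
(missing-input `Prop`s), NOT attempted. This is not "finishing BSD". Research routes; no claim
beyond the stated classes; nothing booked; no label changes. THEOREMS ONLY (no definition, no named
fact, no `sorry`); every published theorem enters as one of the tree's existing named Literature
facts BY NAME; every unproved / untyped-in-Literature statement enters as an EXPLICIT binder.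

## What this file records

Gen 5 (`MainConjecturesControlPublishedClass.lean`) discharged the anticyclotomic CONTROL link
(CTL)ᵍ of the covered irreducible rank-one rows by the published CGLS 2022 Thm. 5.1.1 — but only OFF
the anomalous line `a_p ≢ 1 (mod p)` (Thm. 5.1.1's hypothesis `E(ℚ_p)[p] = 0`) and in CGLS's
convention (log at the relaxed prime). The source theorem of CGLS 5.1.1 — **Jetchev–Skinner–Wan 2017
Thm. 3.3.1 with (3.5.d)** — is now a Literature named fact on the same Literature object
(`JetchevSkinnerWan2017.thm331_anticyclotomicControl`, this seat): it has NO `E(ℚ_p)[p] = 0` and NO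
ordinarity hypothesis, assumes instead (irred_𝒦) "`E[p]` is an irreducible `G_𝒦`-module", and is
stated in JSW's = Castella's convention (module strict at the prime `v` induced by the embedding,
log on `E(𝒦_v)`), which is EXACTLY the convention of the cell's predicate
`X11b.ControlOnTreeGoodAt p κ v γ ι P` and of gen 3's class binders. Consequences proved here:

* §1 `X11b.controlOnTreeGoodAt_of_thm331` — JSW 3.3.1 ⟹ `ControlOnTreeGoodAt p κ v γ ι P` at every
  datum of the theorem (`p ≥ 3` GOOD — ordinary or supersingular, anomalous or not —, `K` imaginary
  quadratic with `p` and every `ℓ ∣ N` split, `ι` inducing `v`, `κ` anticyclotomic with generator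
  `γ`, `E[p]` irreducible over `K`, `rank_ℤ E(K) = 1`, `#Ш(E/K)[p^∞] < ∞`, `P` of infinite order);
  `…_of_inducedPlace` (the datum `v := inducedPlace ι` from an embedding alone).
* §2 `X11b.indexLowerBoundAt_of_heegner_of_thm331[_of_embedding]` — STEP L `IndexLowerBoundAt W p
  K P_K` at a classical Heegner datum with `ord_{s=1} L(E,s) = 1`, for EVERY good `p ≥ 3` split in
  `K`, from the typed (IMC≥∘BDP)ᵍ `hIW` at `(κ, γ, v, ι)` + the PUBLISHED JSW 3.3.1 + GZ + Kolyvagin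
  + GZK + modularity + (irred_K); the hypotheses `rank_ℤ E(K) = 1`, `#Ш(E/K)[p^∞] < ∞`, `P_K`
  non-torsion are discharged as in lit-cgls's §3. Serves the supersingular class X6 ∩ {`r = 1`}
  (lit-cw's `(CTL)` binder) as well as the ordinary rows.
* §3 class level, control PUBLISHED AT EVERY PAIR (no `hna`):
  `bsdp_rankOne_of_thm331_of_columnMainConjecture_odd` (generic odd `p`: typed column MC +
  JSW 3.3.1 + typed (IMC≥∘BDP)ᵍ in JSW/Castella convention `(κ, γ, inducedPlace ι, ι)` + (irred_K)
  at the Heegner fields `hIrrK` + cited control ⇒ `BSD(E,p)`); the row theorems (C2, C16, C3) are in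
  the companion `MainConjecturesControlJSWClass.lean`.

The binder `hIrrK` — (irred_𝒦) at the imaginary quadratic fields with `p` split — is JSW's own
hypothesis; in print it follows from (sur) (the image of `G_𝒦` has index `≤ 2` in `GL₂(𝔽_p)`, hence
contains `SL₂(𝔽_p)`) and from (irr) + (ram) (Skinner, Ann. Math. 191 (2020) Lemma 2.8.1, printed for
`ℓ` non-split in `𝒦`; JSW §7.4.1 p. 30); neither implication is a tree theorem yet (the tree has no
bridge between `ρ̄_{E,p}` on `E(ℚ̄)[p]` and on `E(K̄)[p]`), so it is carried explicitly — the ONE new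
binder, against the removal of `hna` (gen 5) / `hLC` (gen 3). Nothing here changes a label: the other
antecedent (IMC≥∘BDP)ᵍ stays typed (BCS 2025 Thm. 1.2.4 / Yan–Zhu 2026 Thm. 4.12 / CGLS Thm. 4.2.2,
whose `L_p^{BDP}` has no Literature object yet — lit-cgls S1b).

References: [JetchevSkinnerWan2017] Thm. 3.3.1, §3.5 (3.5.d), §7.4.1; [CastellaGrossiLeeSkinner2022]
Thm. 5.1.1; [Castella2018] Thm. 2.3, Thm. 3.2; [BurungaleCastellaSkinner2025] Thm. 1.1.2 (b), 1.2.4,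
Cor. 1.3.1; [YanZhu2024MainConjNonCM] Thm. 4.9, 4.12, 4.15; [Skinner2020] Lemma 2.8.1;
[Miller2011LMS] Def. 1.1; HOME/b2b-bsdres-lit-glue/GLUE.md GEN 6 ADDENDUM;
HOME/b2b-bsdres-lit-cgls/CGLS-GV-TYPING.md §12.10–12.11.
-/

set_option autoImplicit false

noncomputable section

open scoped Classical

open WeierstrassCurve NumberField IsDedekindDomain Literature.NumberTheory.EllipticCurves
  Literature.NumberTheory.EllipticCurves.ModularForms Literature.NumberTheory.Automorphic
  Literature.NumberTheory.EllipticCurves.Rank1Residual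
  Literature.NumberTheory.EllipticCurves.YanZhu2026
  Literature.NumberTheory.EllipticCurves.BurungaleCastellaSkinner2025
  Literature.NumberTheory.EllipticCurves.BurungaleKobayashiOta2024
  Literature.NumberTheory.EllipticCurves.CastellaGrossiLeeSkinner2022
  Literature.NumberTheory.EllipticCurves.JetchevSkinnerWan2017
  Summit.BirchSwinnertonDyer.BirchSwinnertonDyer.Theorems.Rank1ResidualX1Defs

namespace Summit.BirchSwinnertonDyer.Rank1Residual

namespace X11b

/-! ### §1 (CTL)ᵍ at a datum from JSW 2017 Thm. 3.3.1 -/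

section Control

variable {W : WeierstrassCurve ℚ} [W.IsElliptic] [W.IsGloballyMinimal] {p : ℕ} [Fact p.Prime]
  {K : Type} [Field K] [NumberField K]

/-- **`X11b.ControlOnTreeGoodAt` FROM Jetchev–Skinner–Wan 2017 Thm. 3.3.1 (+ (3.5.d)).** At every
datum of the theorem — `W/ℚ` globally minimal, `p ≥ 3` of GOOD reduction (ordinary or supersingular,
anomalous or not), `K` imaginary quadratic with `p` split and every `ℓ ∣ N` split, `ι : K ↪ ℚ_p`
inducing the STRICT prime `v`, `κ` anticyclotomic with generator `γ`, `E[p]` an irreducible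
`G_K`-module, `rank_ℤ E(K) = 1`, `#Ш(E/K)[p^∞] < ∞`, `P` of infinite order — the cell's typed link
`ControlOnTreeGoodAt p κ v γ ι P` HOLDS, fed by the named fact through the defeq bridge
(`AcSelmer.hasCharValuationAt_iff_literature`, `padicLogOrd_eq_literature`) and the all-split
Tamagawa identity `ord_p ∏_{w∣N⁺} c_w = ord_p ∏_w c_w(E/K)` (`padicValNat_tamagawa_of_heegner_anyPrime`).
[cite: JetchevSkinnerWan2017, Thm. 3.3.1 with §3.5 (3.5.d) (arXiv:1512.06894 pp. 11, 16)]
[cite: Castella2018, Thm. 2.3 (arXiv:1704.06608 p. 5)] [cite: JetchevSkinnerWan2017, §7.3.1 (eq:tamK)] -/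
theorem controlOnTreeGoodAt_of_thm331 (h331 : thm331_anticyclotomicControl) (hp : 3 ≤ p)
    (hgood : Good W p) (hK : IsImaginaryQuadratic K) (hHp : SatisfiesHeegnerHypothesis p K)
    {N : ℕ} (hN : W.conductorNorm ℤ = N) (hHN : SatisfiesHeegnerHypothesis N K)
    (hirrK : (W.baseChange K).HasIrreducibleModPGaloisRep p)
    (ι : K →+* ℚ_[p]) (v : HeightOneSpectrum (𝓞 K))
    (hv : ∀ x : 𝓞 K, x ∈ v.asIdeal ↔ ‖ι (x : K)‖ < 1)
    (κ : ZpExtension K p) (hκ : κ.IsAnticyclotomic)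
    (γ : Field.absoluteGaloisGroup K) [Fact (κ.IsTopGenerator γ)]
    (hrk : (W.baseChange K).mordellWeilRank = 1)
    (hfin : Finite (AddCommGroup.primaryComponent (W.baseChange K).sha p))
    (P : (W.baseChange K).toAffine.Point) (hP : ¬ IsOfFinAddOrder P) :
    ControlOnTreeGoodAt p κ v γ ι P := by
  have hHN' : SatisfiesHeegnerHypothesis (W.conductorNorm ℤ) K := by rw [hN]; exact hHN
  obtain ⟨n, hn, hval⟩ := hasCharValuationAt_of_thm331 h331 hp hgood K hK hHp hHN' hirrK ι v hv κ hκ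
    γ hrk hfin P hP
  obtain ⟨h1, -⟩ := padicValNat_tamagawa_of_heegner_anyPrime (W := W) p hK hN hHN
  refine ⟨n, (AcSelmer.hasCharValuationAt_iff_literature _ p κ v ∅ γ n).mpr hn, ?_⟩
  rw [h1, padicLogOrd_eq_literature]
  omega

/-- **(CTL)ᵍ from JSW 3.3.1 at the datum of an EMBEDDING alone**: `v := inducedPlace ι` (the prime
induced by `ι`, `mem_inducedPlace_iff`). [cite: JetchevSkinnerWan2017, Thm. 3.3.1 with §3.5 (3.5.d)] -/
theorem controlOnTreeGoodAt_of_thm331_of_inducedPlace (h331 : thm331_anticyclotomicControl)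
    (hp : 3 ≤ p) (hgood : Good W p) (hK : IsImaginaryQuadratic K)
    (hHp : SatisfiesHeegnerHypothesis p K) {N : ℕ} (hN : W.conductorNorm ℤ = N)
    (hHN : SatisfiesHeegnerHypothesis N K) (hirrK : (W.baseChange K).HasIrreducibleModPGaloisRep p)
    (ι : K →+* ℚ_[p]) (κ : ZpExtension K p) (hκ : κ.IsAnticyclotomic)
    (γ : Field.absoluteGaloisGroup K) [Fact (κ.IsTopGenerator γ)]
    (hrk : (W.baseChange K).mordellWeilRank = 1)
    (hfin : Finite (AddCommGroup.primaryComponent (W.baseChange K).sha p))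
    (P : (W.baseChange K).toAffine.Point) (hP : ¬ IsOfFinAddOrder P) :
    ControlOnTreeGoodAt p κ (inducedPlace ι) γ ι P :=
  controlOnTreeGoodAt_of_thm331 h331 hp hgood hK hHp hN hHN hirrK ι (inducedPlace ι)
    (mem_inducedPlace_iff ι) κ hκ γ hrk hfin P hP

end Control

/-! ### §2 STEP L at a classical Heegner datum, EVERY good `p ≥ 3`: (CTL)ᵍ published, (IMC≥∘BDP)ᵍ typed -/

section Datum

variable (W : WeierstrassCurve ℚ) [W.IsElliptic] [W.IsGloballyMinimal] (p : ℕ) [Fact p.Prime]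
  (N : ℕ) [NeZero N] (K : Type) [Field K] [NumberField K]
  (Dt : ModularParametrizationData W N) (H : HeegnerDatum N (NumberField.discr K)) (ιC : K →+* ℂ)
  (P : (W.baseChange K).toAffine.Point)

/-- **STEP L `X11b.IndexLowerBoundAt W p K P_K` with the control link DISCHARGED by JSW 2017
Thm. 3.3.1, at EVERY good prime `p ≥ 3`.** Data: `W/ℚ` globally minimal, `ord_{s=1} L(E,s) = 1`,
`p ≥ 3` of good reduction (ordinary OR supersingular, anomalous allowed), `K` imaginary quadratic with
every `ℓ ∣ N = N_E` split and `p` split, `L(E^{d_K},1) ≠ 0`, `P = P_K` the Heegner point of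
`(Dt, H, ιC)`, `E[p]` irreducible over `K`; links at one datum `(κ, γ, v, ι)` with `ι : K ↪ ℚ_p`
inducing `v` (the strict prime). Inputs: the TYPED (IMC≥∘BDP)ᵍ `hIW` and the PUBLISHED facts
`h331` (JSW Thm. 3.3.1), `hGZ` (Gross–Zagier), `hKo` (Kolyvagin), `hmod` (modularity), `hGZK`
(Gross–Zagier–Kolyvagin over `ℚ`). The hypotheses of Thm. 3.3.1 are discharged: `rank_ℤ E(K) = 1`
and `#Ш(E/K)[p^∞] < ∞` (`hGZK` for `E` and `E^{d_K}`,
`mordellWeilRank_baseChange_eq_one_and_finite_sha_of_twist_L_one_ne_zero`), `P_K` of infinite order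
(`not_isOfFinAddOrder_of_heegner_of_analyticRank_eq_one`). The twin of lit-cgls's
`indexLowerBoundAt_of_heegner_of_thm511` WITHOUT `a_p ≢ 1` and WITHOUT ordinarity.
[cite: JetchevSkinnerWan2017, Thm. 3.3.1 with §3.5 (3.5.d), §7.4.1 (eq:shalowerK-1) (arXiv:1512.06894 pp. 11, 16, 30)]
[cite: Kolyvagin1990, Thm. A] [cite: GrossLMS1991, Thm. 1.3] -/
theorem indexLowerBoundAt_of_heegner_of_thm331 (h331 : thm331_anticyclotomicControl)
    (hGZ : gross_zagier N W K) (hKo : kolyvagin N W K) (hmod : hasEntireLFunction_rat)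
    (hGZK : rank_eq_analyticRank_of_analyticRank_le_one)
    (hp : 3 ≤ p) (hgood : Good W p) (hr : W.analyticRank = 1) (hN : W.conductorNorm ℤ = N)
    (hK : IsImaginaryQuadratic K) (hHN : SatisfiesHeegnerHypothesis N K)
    (hHp : SatisfiesHeegnerHypothesis p K) (hirrK : (W.baseChange K).HasIrreducibleModPGaloisRep p)
    (hLt : (W.quadraticTwist (NumberField.discr K : ℚ)).entireLFunction 1 ≠ 0)
    (hP : WeierstrassCurve.Affine.Point.map ιC.toRatAlgHom P = heegnerPointComplex Dt H)
    {κ : ZpExtension K p} (hκ : κ.IsAnticyclotomic) {γ : Field.absoluteGaloisGroup K}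
    [Fact (κ.IsTopGenerator γ)] (ι : K →+* ℚ_[p]) (v : HeightOneSpectrum (𝓞 K))
    (hv : ∀ x : 𝓞 K, x ∈ v.asIdeal ↔ ‖ι (x : K)‖ < 1)
    (hIW : IMCLowerWaldspurgerOnTreeGoodAt p κ v γ ι P) :
    IndexLowerBoundAt W p K P := by
  -- rank and `Ш` over `ℚ` from GZK at `r_an = 1`, then over `K` by the descent lemma
  obtain ⟨hrQ, hShaQ⟩ := hGZK W hr.le
  rw [hr] at hrQ
  obtain ⟨hrk, hfin⟩ :=
    mordellWeilRank_baseChange_eq_one_and_finite_sha_of_twist_L_one_ne_zero hGZK W K hK p hrQ hShaQ hLt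
  -- the Heegner point is non-torsion
  have hPinf : ¬ IsOfFinAddOrder P :=
    not_isOfFinAddOrder_of_heegner_of_analyticRank_eq_one W N K Dt H ιC P hGZ hmod hr hK hHN hLt hP
  -- (CTL)ᵍ from the published theorem, then gen 3's STEP-L theorem (any prime)
  have hCTL : ControlOnTreeGoodAt p κ v γ ι P :=
    controlOnTreeGoodAt_of_thm331 h331 hp hgood hK hHp hN hHN hirrK ι v hv κ hκ γ hrk hfin P hPinf
  exact indexLowerBoundAt_of_heegner_of_onTreeGoodLowerLinks_anyPrime W p N K Dt H ιC P hGZ hKo hmod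
    hr hN hK hHN hLt hP hIW hCTL

/-- **STEP L from an EMBEDDING `ι : K ↪ ℚ_p` alone** (`v := inducedPlace ι`): JSW 3.3.1 published +
(IMC≥∘BDP)ᵍ typed at `(κ, γ, inducedPlace ι, ι)`. [cite: JetchevSkinnerWan2017, Thm. 3.3.1 with §3.5 (3.5.d), §7.4.1 (eq:shalowerK-1)] -/
theorem indexLowerBoundAt_of_heegner_of_thm331_of_embedding (h331 : thm331_anticyclotomicControl)
    (hGZ : gross_zagier N W K) (hKo : kolyvagin N W K) (hmod : hasEntireLFunction_rat)
    (hGZK : rank_eq_analyticRank_of_analyticRank_le_one)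
    (hp : 3 ≤ p) (hgood : Good W p) (hr : W.analyticRank = 1) (hN : W.conductorNorm ℤ = N)
    (hK : IsImaginaryQuadratic K) (hHN : SatisfiesHeegnerHypothesis N K)
    (hHp : SatisfiesHeegnerHypothesis p K) (hirrK : (W.baseChange K).HasIrreducibleModPGaloisRep p)
    (hLt : (W.quadraticTwist (NumberField.discr K : ℚ)).entireLFunction 1 ≠ 0)
    (hP : WeierstrassCurve.Affine.Point.map ιC.toRatAlgHom P = heegnerPointComplex Dt H)
    {κ : ZpExtension K p} (hκ : κ.IsAnticyclotomic) {γ : Field.absoluteGaloisGroup K}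
    [Fact (κ.IsTopGenerator γ)] (ι : K →+* ℚ_[p])
    (hIW : IMCLowerWaldspurgerOnTreeGoodAt p κ (inducedPlace ι) γ ι P) :
    IndexLowerBoundAt W p K P :=
  indexLowerBoundAt_of_heegner_of_thm331 W p N K Dt H ιC P h331 hGZ hKo hmod hGZK hp hgood hr hN hK
    hHN hHp hirrK hLt hP hκ ι (inducedPlace ι) (mem_inducedPlace_iff ι) hIW

end Datum

/-! ### §2b Non-vacuity: at every embedding the published link holds at the induced prime -/

section NonVacuity

variable {W : WeierstrassCurve ℚ} [W.IsElliptic] [W.IsGloballyMinimal] {p : ℕ} [Fact p.Prime]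
  {K : Type} [Field K] [NumberField K]

/-- **For every embedding `ι : K ↪ ℚ_p` and every anticyclotomic `(κ, γ)` the cell's control link
`ControlOnTreeGoodAt p κ (inducedPlace ι) γ ι P` HOLDS — published (JSW Thm. 3.3.1) — for every `P`
of infinite order, under the theorem's hypotheses** (good `p ≥ 3`, `K` imaginary quadratic with `p`
and every `ℓ ∣ N` split, `E[p]` irreducible over `K`, `rank_ℤ E(K) = 1`, `#Ш(E/K)[p^∞] < ∞`); in
particular at THE embedding `embAt K p 𝔭` of every degree-one prime `𝔭 ∣ p` — the quantifier domain
of gen 3's `hLC` binder. [cite: JetchevSkinnerWan2017, Thm. 3.3.1 with §3.5 (3.5.d)] -/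
theorem forall_controlOnTreeGoodAt_of_thm331 (h331 : thm331_anticyclotomicControl) (hp : 3 ≤ p)
    (hgood : Good W p) (hK : IsImaginaryQuadratic K) (hHp : SatisfiesHeegnerHypothesis p K)
    {N : ℕ} (hN : W.conductorNorm ℤ = N) (hHN : SatisfiesHeegnerHypothesis N K)
    (hirrK : (W.baseChange K).HasIrreducibleModPGaloisRep p)
    (hrk : (W.baseChange K).mordellWeilRank = 1)
    (hfin : Finite (AddCommGroup.primaryComponent (W.baseChange K).sha p)) :
    ∀ (ι : K →+* ℚ_[p]) (κ : ZpExtension K p), κ.IsAnticyclotomic →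
      ∀ (γ : Field.absoluteGaloisGroup K) [Fact (κ.IsTopGenerator γ)]
        (P : (W.baseChange K).toAffine.Point), ¬ IsOfFinAddOrder P →
        ControlOnTreeGoodAt p κ (inducedPlace ι) γ ι P :=
  fun ι κ hκ γ _ P hP ↦ controlOnTreeGoodAt_of_thm331_of_inducedPlace h331 hp hgood hK hHp hN hHN
    hirrK ι κ hκ γ hrk hfin P hP

end NonVacuity

end X11b

/-! ### §3 The irreducible rank-one rows with the control link PUBLISHED at every pair -/

/-- **Rank one, generic odd prime `p ≥ 3`, ANOMALOUS OR NOT: the column's typed cyclotomic main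
conjecture + Jetchev–Skinner–Wan 2017 Thm. 3.3.1 (PUBLISHED anticyclotomic control) + the typed
anticyclotomic main conjecture ∘ BDP + (irred_K) at the Heegner fields ⇒ `BSD(E,p)`.** Gen 5's
`bsdp_rankOne_of_thm511_of_columnMainConjecture_odd` with `h511 ↦ h331` and the binder `hna` (`a_p ≢ 1
(mod p)`) REMOVED; gen 3's `bsdp_rankOne_of_onTreeGoodLinks_of_columnMainConjecture_odd` with its
control binder `hLC` REPLACED by the named fact. The typed input `hLA` = (IMC≥∘BDP)ᵍ is asked in
JSW's = Castella's convention (module strict at the prime induced by the embedding, log at that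
prime): for THIS pair, at every Manin-unit classical Heegner datum over a field with `d_K` odd
`< −4`, every `ℓ ∣ N` and `p` split, `L(E^{d_K},1) ≠ 0`, non-torsion Heegner point, for every
anticyclotomic `κ`, generator `γ` and embedding `ι : K →+* ℚ_p`, at the strict prime `inducedPlace ι`
(PUBLISHED shape on these data: BCS 2025 Thm. 1.2.4 / Yan–Zhu 2026 Thm. 4.12 ∘ Castella 2018
Thm. 3.2). The NEW binder `hIrrK` is JSW's hypothesis (irred_𝒦) at the imaginary quadratic fields
with `p` split (in print ⇐ (sur), or ⇐ (irr) + (ram) by Skinner 2020 Lemma 2.8.1; not a tree theorem).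
STEP L is evaluated at ONE datum: an anticyclotomic `(κ, γ)` and a prime `𝔭 ∣ p` exist
(`X11b.exists_anticyclotomic_generator_prime`), `ι := embAt 𝔭` (degree one as `p` splits),
`v := inducedPlace ι`.
[cite: JetchevSkinnerWan2017, Thm. 3.3.1 with §3.5 (3.5.d), §7.4.1 (eq:shalowerK-1)]
[cite: BurungaleCastellaSkinner2025, Thm. 1.2.4, Cor. 1.3.1 (r = 1)] [cite: YanZhu2024MainConjNonCM, Thm. 4.12]
[cite: Castella2018, Thm. 3.2 (p. 9)] [cite: Skinner2020, Lemma 2.8.1 (§2.8)] [cite: Miller2011LMS, Def. 1.1] -/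
theorem bsdp_rankOne_of_thm331_of_columnMainConjecture_odd
    -- published inputs (named facts of the tree)
    (hGZ : ∀ (N : ℕ) [NeZero N] (W : WeierstrassCurve ℚ) (K : Type) [Field K] [NumberField K],
      gross_zagier N W K)
    (hKo : ∀ (N : ℕ) [NeZero N] (W : WeierstrassCurve ℚ) (K : Type) [Field K] [NumberField K],
      kolyvagin N W K)
    (hB : ∀ (N : ℕ) [NeZero N] (W : WeierstrassCurve ℚ) (K : Type) [Field K] [NumberField K],
      Kolyvagin1990_padicValNat_card_sha_le N W K)
    (h331 : thm331_anticyclotomicControl)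
    (hGr : greenberg_charValue_rankZero) (hGZK : rank_eq_analyticRank_of_analyticRank_le_one)
    (hmod : hasEntireLFunction_rat) (hpar : nonempty_modularParametrizationData)
    (hnf : exists_isNewformOf) (hHL : HoffsteinLuo1997_exists_twist_L_one_ne_zero)
    (hMaz : mazur_not_dvd_maninConstant_of_odd) (hNS : integral_neronScaling_of_isGloballyMinimal)
    -- the pair (anomalous allowed)
    (W : WeierstrassCurve ℚ) [W.IsElliptic] [W.IsGloballyMinimal] (p : ℕ) [Fact p.Prime]
    (hp3 : 3 ≤ p) (hord : GoodOrd W p) (hsurj : Surj W p) (hr : W.analyticRank = 1)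
    (htam0 : ¬ p ∣ W.tamagawaProduct)
    -- the column's typed cyclotomic main conjecture at `p`, and the (im)-from-surj witness at `p`
    (hMC : ∀ (V : WeierstrassCurve ℚ) [V.IsElliptic] [V.IsGloballyMinimal],
      GoodOrd V p → Irr V p → BigIm V p → MazurMainConjecture V p)
    (hIm : ∀ (V : WeierstrassCurve ℚ) [V.IsElliptic] [V.IsGloballyMinimal],
      GoodOrd V p → Surj V p → BigIm V p)
    -- (irred_K) at the imaginary quadratic fields with `p` split — JSW's hypothesis, the NEW binder
    (hIrrK : ∀ (K : Type) [Field K] [NumberField K], IsImaginaryQuadratic K →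
      SatisfiesHeegnerHypothesis (W.conductorNorm ℤ) K → SatisfiesHeegnerHypothesis p K →
      (W.baseChange K).HasIrreducibleModPGaloisRep p)
    -- (IMC≥∘BDP)ᵍ at this pair's classical Heegner data, JSW/Castella convention — the typed input
    (hLA : ∀ (N : ℕ) [NeZero N] (K : Type) [Field K] [NumberField K]
      (Dt : ModularParametrizationData W N) (H : HeegnerDatum N (NumberField.discr K)) (ιC : K →+* ℂ)
      (P : (W.baseChange K).toAffine.Point),
      W.conductorNorm ℤ = N → IsImaginaryQuadratic K → Odd (NumberField.discr K) →
      NumberField.discr K < -4 → SatisfiesHeegnerHypothesis N K → SatisfiesHeegnerHypothesis p K →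
      (W.quadraticTwist (NumberField.discr K : ℚ)).entireLFunction 1 ≠ 0 →
      WeierstrassCurve.Affine.Point.map ιC.toRatAlgHom P = heegnerPointComplex Dt H →
      ¬ (p : ℤ) ∣ Dt.c → ¬ IsOfFinAddOrder P →
      ∀ (κ : ZpExtension K p), κ.IsAnticyclotomic →
        ∀ (γ : Field.absoluteGaloisGroup K) [Fact (κ.IsTopGenerator γ)] (ι : K →+* ℚ_[p]),
          X11b.IMCLowerWaldspurgerOnTreeGoodAt p κ (X11b.inducedPlace ι) γ ι P) :
    BSDp W p := by
  refine bsdp_rankOne_of_indexLowerBoundAt_of_columnMainConjecture hGZ hKo hB hGr hGZK hmod hpar hnf hHL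
    hMaz hNS W p hp3 hord hsurj hr htam0 hMC hIm ?_
  intro N _ K _ _ Dt H ιC P hN hK hodd hlt hHN hHp hLt hP hc
  -- the Heegner point is non-torsion (Gross–Zagier + modularity at `r_an = 1`)
  have hPinf : ¬ IsOfFinAddOrder P :=
    X11b.not_isOfFinAddOrder_of_heegner_of_analyticRank_eq_one W N K Dt H ιC P (hGZ N W K) hmod hr hK
      hHN hLt hP
  -- (irred_K) at this field
  have hirrK : (W.baseChange K).HasIrreducibleModPGaloisRep p :=
    hIrrK K hK (by rw [hN]; exact hHN) hHp
  -- one anticyclotomic datum `(κ, γ)`, a prime `𝔭 ∣ p`, the embedding at `𝔭`, its induced prime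
  obtain ⟨κ, γ, 𝔭, hκ, hγ, h𝔭⟩ := X11b.exists_anticyclotomic_generator_prime (p := p) hK
  haveI : Fact (κ.IsTopGenerator γ) := ⟨hγ⟩
  have hsplit : X11b.SplitsIn K p := hHp p Fact.out (dvd_refl p)
  obtain ⟨he, hf⟩ := X11b.degreeOne_of_splitsIn hK.1 hsplit h𝔭
  set ι : K →+* ℚ_[p] := X11b.embAt K p 𝔭 h𝔭 he hf with hι
  exact X11b.indexLowerBoundAt_of_heegner_of_thm331_of_embedding W p N K Dt H ιC P h331 (hGZ N W K)
    (hKo N W K) hmod hGZK hp3 hord.1 hr hN hK hHN hHp hirrK hLt hP hκ ι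
    (hLA N K Dt H ιC P hN hK hodd hlt hHN hHp hLt hP hc hPinf κ hκ γ ι)


end Summit.BirchSwinnertonDyer.Rank1Residual

end
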